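import Literature.Geometry.Riemannian.SphericalCylinderEntropy
import Literature.Topology.FourManifolds.WhitneyModelSheets
import Mathlib.Geometry.Manifold.LocalDiffeomorph
import Mathlib.Geometry.Manifold.Instances.Sphere
import HarnessLib

/-!
# A graphical cross-section of `S⁴ × ℝ` is a standard sphere

Stub `stub_graphicalIsSphere` of line `killing-flux` for the crux `CylinderEntropy.CylinderRungTwo`
(stmt-SmoothPoincare4-7631): the differential-topology endgame of the line.

## What

Let `N = {z ∈ ℝ⁶ | ∑_{i<5} zᵢ² = 1} = S⁴ × ℝ` and let `ι : M → ℝ⁶` be a smooth embedding of a compact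
connected boundaryless `4`-manifold `M` with image in `N` whose *shadow* `truncL ∘ ι : M → ℝ⁵`
(`truncL` drops the height coordinate `z₅`) is an injective immersion (injective, with injective
differential everywhere). Then `M` is diffeomorphic to the unit sphere `S⁴ ⊂ ℝ⁵` with Mathlib's
(stereographic) manifold structure (`stub_graphicalIsSphere`, registered signature).

## Proof (fact-free)

The shadow lands in `S⁴` (`∑_{i<5} (ι x)ᵢ² = 1`), so it co-restricts to `g : M → S⁴`, smooth by
`ContMDiff.codRestrict_sphere`. Since `Subtype.val ∘ g = truncL ∘ ι`, the chain rule gives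
injectivity of `mfderiv g x` from that of `mfderiv (truncL ∘ ι) x`; as `dim M = dim S⁴ = 4`, the
inverse function theorem (tree
`Literature.Topology.FourManifolds.isLocalDiffeomorphAt_of_mfderiv_injective`) makes `g` a local
diffeomorphism. Hence `range g` is open (`IsLocalDiffeomorph.isOpen_range`), and it is closed (compact
image) and nonempty; `S⁴` is connected, so `g` is surjective. It is injective because `truncL ∘ ι` is,
and a bijective local diffeomorphism is a diffeomorphism (`IsLocalDiffeomorph.diffeomorphOfBijective`).

## References

* [HirschDT1976] M. W. Hirsch, *Differential Topology*, GTM 33, Springer 1976, Ch. 1 §3 Thm. 3.1.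
* [LeeSmoothManifolds2013] J. M. Lee, *Introduction to Smooth Manifolds*, 2nd ed., GTM 218,
  Springer 2013, Thm. 4.5 and Prop. 4.8.
-/

-- the prescribed namespace `Summit.SmoothPoincare4.SmoothPoincare4.…` repeats `SmoothPoincare4`
set_option linter.dupNamespace false

noncomputable section

open scoped Manifold ContDiff
open Function Set
open Literature.Geometry.Riemannian.SphericalCylinderEntropy (truncL truncL_apply)

namespace Summit.SmoothPoincare4.SmoothPoincare4.Theorems.CylinderRungTwo.KillingFlux

/-- A point `z ∈ ℝ⁶` of the cylinder `N = {∑_{i<5} zᵢ² = 1}` has its shadow `truncL z` on the unit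
sphere of `ℝ⁵`. [folklore] -/
theorem truncL_mem_sphere {z : EuclideanSpace ℝ (Fin 6)}
    (hz : ∑ i : Fin 5, z (Fin.castSucc i) ^ 2 = 1) :
    truncL z ∈ Metric.sphere (0 : EuclideanSpace ℝ (Fin 5)) 1 := by
  rw [mem_sphere_zero_iff_norm, EuclideanSpace.norm_eq, Real.sqrt_eq_one]
  simpa [truncL_apply, Real.norm_eq_abs, sq_abs] using hz

/-- **A local diffeomorphism from a nonempty compact space to a (pre)connected Hausdorff manifold is
surjective**: its range is open (`IsLocalDiffeomorph.isOpen_range`), closed (compact) and nonempty.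
[folklore] -/
theorem surjective_of_isLocalDiffeomorph {E : Type*} [NormedAddCommGroup E] [NormedSpace ℝ E]
    {H : Type*} [TopologicalSpace H] {I : ModelWithCorners ℝ E H} {X : Type*} [TopologicalSpace X]
    [ChartedSpace H X] {E' : Type*} [NormedAddCommGroup E'] [NormedSpace ℝ E'] {H' : Type*}
    [TopologicalSpace H'] {J : ModelWithCorners ℝ E' H'} {Y : Type*} [TopologicalSpace Y]
    [ChartedSpace H' Y] {n : WithTop ℕ∞} [CompactSpace X] [Nonempty X] [T2Space Y]
    [PreconnectedSpace Y] {f : X → Y} (hf : IsLocalDiffeomorph I J n f) : Surjective f := by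
  have hclopen : IsClopen (range f) :=
    ⟨(isCompact_range hf.contMDiff.continuous).isClosed, hf.isOpen_range⟩
  exact range_eq_univ.mp (hclopen.eq_univ (range_nonempty f))

/-- **A graphical cross-section is a standard sphere** (stub `stub_graphicalIsSphere` of line
`killing-flux`, crux `CylinderEntropy.CylinderRungTwo`). If `M` is a compact connected boundaryless
`4`-manifold and `ι : M → ℝ⁶` a smooth embedding into the cylinder `N = {∑_{i<5} zᵢ² = 1}` whose
shadow `truncL ∘ ι : M → ℝ⁵` is injective with everywhere injective differential, then
`M ≃ₘ S⁴`: the shadow co-restricts to a smooth injective local diffeomorphism `M → S⁴` (inverse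
function theorem), whose image is open and compact in the connected `S⁴`, i.e. a bijective local
diffeomorphism, i.e. a diffeomorphism. [cite: HirschDT1976, Ch. 1 §3 Thm. 3.1] -/
theorem stub_graphicalIsSphere :
    ∀ (M : Type) [TopologicalSpace M] [T2Space M] [SecondCountableTopology M]
      [ChartedSpace (EuclideanSpace ℝ (Fin 4)) M] [IsManifold (𝓡 4) ∞ M] [CompactSpace M]
      [ConnectedSpace M] (ι : M → EuclideanSpace ℝ (Fin 6)),
      Manifold.IsSmoothEmbedding (𝓡 4) (𝓡 6) ∞ ι →
      (∀ x, ∑ i : Fin 5, ι x (Fin.castSucc i) ^ 2 = 1) →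
      (Function.Injective ((truncL : EuclideanSpace ℝ (Fin 6) → EuclideanSpace ℝ (Fin 5)) ∘ ι) ∧
        ∀ x : M, Function.Injective
          (mfderiv (𝓡 4) (𝓡 5) ((truncL : EuclideanSpace ℝ (Fin 6) → EuclideanSpace ℝ (Fin 5)) ∘ ι) x)) →
      Nonempty (M ≃ₘ⟮𝓡 4, 𝓡 4⟯ Metric.sphere (0 : EuclideanSpace ℝ (Fin 5)) 1) := by
  intro M _ _ _ _ _ _ _ ι hι hN hgraph
  obtain ⟨hinj, hdinj⟩ := hgraph
  haveI : Fact (Module.finrank ℝ (EuclideanSpace ℝ (Fin 5)) = 4 + 1) := ⟨finrank_euclideanSpace_fin⟩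
  -- the shadow lands in the unit sphere `S⁴ ⊂ ℝ⁵`
  have hmem : ∀ x, ((truncL : EuclideanSpace ℝ (Fin 6) → EuclideanSpace ℝ (Fin 5)) ∘ ι) x ∈
      Metric.sphere (0 : EuclideanSpace ℝ (Fin 5)) 1 := fun x => truncL_mem_sphere (hN x)
  -- its co-restriction `g : M → S⁴`
  set g : M → Metric.sphere (0 : EuclideanSpace ℝ (Fin 5)) 1 := Set.codRestrict _ _ hmem with hg
  have hval_g : (Subtype.val ∘ g) =
      ((truncL : EuclideanSpace ℝ (Fin 6) → EuclideanSpace ℝ (Fin 5)) ∘ ι) := rfl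
  -- smoothness of the shadow and of `g`
  have hsm : ContMDiff (𝓡 4) (𝓡 5) ∞
      ((truncL : EuclideanSpace ℝ (Fin 6) → EuclideanSpace ℝ (Fin 5)) ∘ ι) :=
    truncL.contDiff.comp_contMDiff hι.contMDiff
  have hgs : ContMDiff (𝓡 4) (𝓡 4) ∞ g := hsm.codRestrict_sphere hmem
  -- the differential of `g` is injective (chain rule through `Subtype.val ∘ g = truncL ∘ ι`)
  have hval : ContMDiff (𝓡 4) (𝓡 5) ∞
      (Subtype.val : Metric.sphere (0 : EuclideanSpace ℝ (Fin 5)) 1 → EuclideanSpace ℝ (Fin 5)) :=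
    contMDiff_coe_sphere
  have hdg : ∀ x, Injective (mfderiv (𝓡 4) (𝓡 4) g x) := by
    intro x
    have hgd : MDifferentiableAt (𝓡 4) (𝓡 4) g x := (hgs x).mdifferentiableAt (by simp)
    have hvd : MDifferentiableAt (𝓡 4) (𝓡 5)
        (Subtype.val : Metric.sphere (0 : EuclideanSpace ℝ (Fin 5)) 1 → EuclideanSpace ℝ (Fin 5))
        (g x) := (hval (g x)).mdifferentiableAt (by simp)
    have h := hdinj x
    rw [← hval_g, mfderiv_comp x hvd hgd] at h
    exact Injective.of_comp h
  -- `g` is a local diffeomorphism (inverse function theorem, equal dimensions)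
  have hloc : IsLocalDiffeomorph (𝓡 4) (𝓡 4) ∞ g := fun x =>
    Literature.Topology.FourManifolds.isLocalDiffeomorphAt_of_mfderiv_injective isOpen_univ
      (mem_univ x) hgs.contMDiffOn (by simp) rfl (hdg x)
  -- `g` is bijective: injective as `truncL ∘ ι` is, surjective by connectedness of `S⁴`
  have hginj : Injective g := (injective_codRestrict hmem).mpr hinj
  haveI := Literature.Geometry.Manifold.CylinderSlice.preconnectedSpace_sphere_four
  have hgsurj : Surjective g := surjective_of_isLocalDiffeomorph hloc
  exact ⟨hloc.diffeomorphOfBijective ⟨hginj, hgsurj⟩⟩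

end Summit.SmoothPoincare4.SmoothPoincare4.Theorems.CylinderRungTwo.KillingFlux

end
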